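/-
Copyright (c) 2026 the pub-hodgecm-mathlib formalisation cell (harness21).  Prover seat hodgecm-mathlib-K2E5-p17 (g8), Track B «K2-LIT»,
#184♮ = hLiu418 = `stmt-HodgeConjecture-24832`; socket #41 — THE TOP, edition 5 «ASSEMBLED»: the ★ letters of KIND 0 (★ p861499 K2Liu-p13, ★ ed. 4a∕4a′) and KIND W
(★ p861446 + ★ p861512 K2E4-p10) CONSUMED BY NAME (author of record, LEAD F0P6-plan (g14) BATCH #46 (a) ∕ #49).  THEOREMS ONLY; NO `Lines` import.
-/
import Summits.HodgeConjecture.HodgeConjecture.Theorems.K2LiuSiegelEisensteinConstantTermFiniteness        -- ★ ed. 4a′ (this seat) ⊇ ed. 4a ⊇ ed. 3b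
import Summits.HodgeConjecture.HodgeConjecture.Theorems.K2LiuSiegelEisensteinKindZeroBigCellLetters         -- ★ p861499 `standardFamily_growth`, `exists_E₈`
import Summits.HodgeConjecture.HodgeConjecture.Theorems.K2LiuSiegelEisensteinWhittakerTermPackageFixedCarrier  -- ★ p861446 `exists_whittaker_packages_fourierCoeff_fixedCarrier`
import Summits.HodgeConjecture.HodgeConjecture.Theorems.K2LiuSiegelEisensteinWhittakerMajorant              -- ★ p861512 `whittaker_majorant∕summedGrowth_of_weightedGrowth`
import HarnessLib

/-!
# Crux `HLiu418`, socket #41 — THE TOP, edition 5 «ASSEMBLED»: socket #41 from the REMAINING by-value letters only —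
# big-cell scalar + continuation, middle-cell package, rank-one packages + weighted growth, Whittaker factor data + weighted growth + Euler identity

Cell `hodgecm-mathlib`, crux item hLiu418 = `stmt-HodgeConjecture-24832` (helper lane until the typist's tie; count-neutral).

Over ★ edition 3b `siegelEisensteinContinuation_of_kinds_fixedCarrier` (carrier a binder: `νN` Haar on `N_Δ(𝔸)`, `β` a covering weight with `β ≤ 𝟙_K`, `K` compact, `0 < ∫β < ∞` — the
tie builds it as ★ edition 2 does), THIS EDITION discharges BY NAME: KIND 0's identity-cell growth `hfgr` (★ p861499 `standardFamily_growth`), O41.4's finiteness `hH` (★ ed. 4a′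
`lintegral_tsum_enorm_mul_weight_ne_top`), the big-cell letters `E₈` (★ p861499 `exists_E₈` over ★ p861423 `exists_bigCell_termPackage`), the KIND-0 assembly (★ ed. 4a); KIND W's per-`S`
packages (★ p861446 `exists_whittaker_packages_fourierCoeff_fixedCarrier`) and lattice letters (★ p861512).  WHAT REMAINS BY VALUE (the named surface of record): the pole set `P`;
KIND 0: the big-cell SCALAR NORMALISATION `(r, G, a)` with `(∏(s−p))·r = G` holomorphic, `r·a = 1` (★ O41.6 `a^S∕b^S` at the frame, ★ p861474) and the CONTINUATION `(E, hEd, hEeq)` of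
`a(s)·M(s)f_s(h)` (rows G6-fin∕G6-arch), the rational Weyl presentation `(wq, hwq)` (★ O41.4's), the MIDDLE package `E₇` ((u-0c), un-normalised currency); KIND 1: the per-`S` packages
`(Ec₁, h1off, hd₁, hc₁, hcoef₁)` ((u-1a), ★ p861061 at `X := H(𝔸)`) and the weighted growth `(w₁, h1g)` ((u-1b)); KIND W: the factor data `(WT, G_W, hWTd, hGWd)`, the weighted growth `hg`,
the Euler identity `hRK` with its continuity `hRKc` (rows G1–G4 + the G2 glue) and a summable weight `w`.
HEAD **`siegelEisensteinContinuation_assembled`** ⇒ socket #41's body BYTES VERBATIM.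
Sources: [Tan1999, §1 Main Theorem; §4 Props. 4.1, 4.4, 4.8]; [MoeglinWaldspurger1995, II.1.7, IV.1.8–IV.1.11]; [KudlaRallis1994, §1–§2]; [Liu2021, Lem. B.10 (2), B.12].
HONEST LABEL.  Count-neutral helper until tied; `HC_CM` is proved only modulo the 7 printed citations (2 remaining named inputs: hLiu418 = `stmt-HodgeConjecture-24832`,
h413 = `stmt-HodgeConjecture-24833`) until rung 0 closes.
-/

set_option autoImplicit false
set_option linter.dupNamespace false -- the mandated namespace repeats `HodgeConjecture.HodgeConjecture`

noncomputable section

open scoped Matrix Topology ENNReal NNReal BigOperators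
open NumberField IsDedekindDomain MeasureTheory Filter
open Literature.NumberTheory.Automorphic Literature.NumberTheory.GaloisRepresentations
open Literature.NumberTheory.GelbartRogawski1991 Literature.NumberTheory.GelbartRogawski1991.GRConstruction
open Literature.NumberTheory.K2Lit.SiegelDoubled Literature.MeasureTheory.Group
open Literature.NumberTheory.Automorphic.IdeleClassGroup

namespace Summit.HodgeConjecture.HodgeConjecture.Cruxes.HLiu418.K2LiuSiegelEisensteinContinuationTopAssembled

open K2LiuSiegelUnipotentFourierDefs K2LiuSiegelEisensteinContinuationTopKinds K2LiuSiegelEisensteinConstantTermPackage K2LiuSiegelEisensteinConstantTermFiniteness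
open K2LiuSiegelEisensteinKindZeroBigCellLetters (standardFamily_growth exists_E₈)
open K2LiuSiegelEisensteinWhittakerTermPackageFixedCarrier (exists_whittaker_packages_fourierCoeff_fixedCarrier)
open K2LiuSiegelEisensteinWhittakerMajorant (whittaker_majorant_of_weightedGrowth whittaker_summedGrowth_of_weightedGrowth)

open Classical in
/-- **SOCKET #41, ASSEMBLED (edition 5).**  Socket binders; carrier `(νN Haar, β ≤ 𝟙_K covering weight of positive finite mass)`; pole set `P`; KIND 0: `(wq hwq)` + big-cell scalar
`(r G hG hrG a hra)` + continuation `(E hEd hEeq)` + middle package `(E₇ h7d h7c h7eq h7g)` (un-normalised); KIND 1: `(Ec₁ h1off hd₁ hc₁ hcoef₁)` + weighted growth `(w₁ hw₁ hws₁ h1g)`; KIND W: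
`(WT GW hWTd hGWd w hw hws hg hRKc hRK)`.  THEN socket #41's `∃ P Es, (A1) ∧ … ∧ (A5)` — by ★ p861499, ★ ed. 4a∕4a′, ★ p861446, ★ p861512 into ★ ed. 3b.
[cite: Tan1999, §1 Main Theorem; §4 Props. 4.1, 4.4, 4.8] [cite: MoeglinWaldspurger1995, II.1.7, IV.1.8–IV.1.11] [cite: KudlaRallis1994, §1–§2] [cite: Liu2021, Lem. B.10 (2), B.12] -/
theorem siegelEisensteinContinuation_assembled
    (L : Type) [Field L] [NumberField L] [IsCMField L] {n : ℕ} (e : Fin 2 × Fin 1 ≃ Fin n)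
    (dV : Fin 2 → L) (hdV : ∀ i, IsCMField.complexConj L (dV i) = dV i) (hdV0 : ∀ i, dV i ≠ 0)
    (dW : Fin 1 → L) (hdW : ∀ i, IsCMField.complexConj L (dW i) = dW i) (hdW0 : ∀ i, dW i ≠ 0)
    (lam : IdeleClassGroup L →ₜ* Circle) (hlam : IsConjugateSymplectic L lam) (hw : HasWeight L lam 1)
    (𝒦 : IwasawaDatum L e dV hdV dW hdW) (h𝒦 : 𝒦.IsStd) (f : ℂ → HA L e dV hdV dW hdW → ℂ)
    (hstd : IsStandardSectionFamily 𝒦 (toHeckeCharacter L lam⁻¹) f) (hcont : ∀ s, Continuous (f s))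
    -- the carrier (built by the tie as in ★ edition 2: Haar + ★ (C0) + ★ covering weight)
    [MeasurableSpace (unipDelta L e dV hdV dW hdW)] [BorelSpace (unipDelta L e dV hdV dW hdW)]
    (νN : Measure (unipDelta L e dV hdV dW hdW)) [νN.IsHaarMeasure]
    (β : unipDelta L e dV hdV dW hdW → ℝ≥0∞) (hβ : IsCoveringWeight (unipDeltaRat L e dV hdV dW hdW) β)
    (hβ0 : ∫⁻ u, β u ∂νN ≠ 0) (hβtop : ∫⁻ u, β u ∂νN ≠ ∞)
    {K : Set (unipDelta L e dV hdV dW hdW)} (hK : IsCompact K) (hβK : ∀ u, β u ≤ K.indicator 1 u) (P : Finset ℂ)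
    -- KIND 0: rational Weyl presentation, big-cell scalar + continuation, middle package
    (wq : unipDeltaRat L e dV hdV dW hdW → ratH L e dV hdV dW hdW)
    (hwq : ∀ ν, ((wq ν : ratH L e dV hdV dW hdW) : HA L e dV hdV dW hdW) = weylDelta L e dV hdV dW hdW * ((ν : unipDelta L e dV hdV dW hdW) : HA L e dV hdV dW hdW))
    (r G : ℂ → ℂ) (hG : DifferentiableOn ℂ G {s : ℂ | 0 < s.re}) (hrG : ∀ s : ℂ, (n : ℝ) / 2 < s.re → (∏ p ∈ P, (s - p)) * r s = G s)
    (a : ℂ → ℂ) (hra : ∀ s : ℂ, (n : ℝ) / 2 < s.re → r s * a s = 1)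
    (E : ℂ → HA L e dV hdV dW hdW → ℂ) (hEd : ∀ x : HA L e dV hdV dW hdW, DifferentiableOn ℂ (fun s : ℂ => E s x) {s : ℂ | 0 < s.re})
    (hEeq : ∀ (s : ℂ) (x : HA L e dV hdV dW hdW), (n : ℝ) / 2 < s.re → E s x = a s * intertwiningDelta L e dV hdV dW hdW νN (f s) x)
    (E₇ : ℂ → HA L e dV hdV dW hdW → ℂ) (h7d : ∀ h : HA L e dV hdV dW hdW, DifferentiableOn ℂ (fun s => E₇ s h) {s : ℂ | 0 < s.re})
    (h7c : ∀ s : ℂ, 0 < s.re → Continuous (E₇ s))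
    (h7eq : ∀ (s : ℂ) (h : HA L e dV hdV dW hdW), (n : ℝ) / 2 < s.re →
      E₇ s h = (∏ p ∈ P, (s - p)) * ∫ u, (β u).toReal •
        (∑' q : ↥(({Quotient.mk (MulAction.orbitRel (siegelDeltaRat L e dV hdV dW hdW) (ratH L e dV hdV dW hdW)) 1} ∪
            Set.range (fun ν : unipDeltaRat L e dV hdV dW hdW =>
              (Quotient.mk (MulAction.orbitRel (siegelDeltaRat L e dV hdV dW hdW) (ratH L e dV hdV dW hdW)) (wq ν) :
                SiegelDeltaQuot L e dV hdV dW hdW)))ᶜ : Set (SiegelDeltaQuot L e dV hdV dW hdW)),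
          f s ((((Quotient.out (q : SiegelDeltaQuot L e dV hdV dW hdW) : ratH L e dV hdV dW hdW) : HA L e dV hdV dW hdW)) *
            ((u : HA L e dV hdV dW hdW) * h))) ∂νN)
    (h7g : ∀ z : ℂ, 0 < z.re → ∃ C A r : ℝ, 0 < r ∧ ∀ s : ℂ, dist s z < r → ∀ h : HA L e dV hdV dW hdW,
      ‖E₇ s h‖ ≤ C * adelicHeightGL (n + n) L (h : GL (Fin (n + n)) (AdeleRing (𝓞 L) L)) ^ A)
    -- KIND 1: per-S packages + weighted growth
    (Ec₁ : skewMatrices ((IsCMField.complexConj L : L ≃ₐ[Fp L] L) : L →+* L) ((gramR L e dV hdV dW hdW).map (algebraMap (Fp L) L)) → ℂ → HA L e dV hdV dW hdW → ℂ)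
    (h1off : ∀ S : skewMatrices ((IsCMField.complexConj L : L ≃ₐ[Fp L] L) : L →+* L) ((gramR L e dV hdV dW hdW).map (algebraMap (Fp L) L)),
      ¬ ((S : Matrix (Fin n) (Fin n) L) ≠ 0 ∧ (S : Matrix (Fin n) (Fin n) L).det = 0) → ∀ s h, Ec₁ S s h = 0)
    (hd₁ : ∀ S (h : HA L e dV hdV dW hdW), DifferentiableOn ℂ (fun s => Ec₁ S s h) {s : ℂ | 0 < s.re})
    (hc₁ : ∀ S (s : ℂ), 0 < s.re → Continuous (Ec₁ S s))
    (hcoef₁ : ∀ (S : skewMatrices ((IsCMField.complexConj L : L ≃ₐ[Fp L] L) : L →+* L) ((gramR L e dV hdV dW hdW).map (algebraMap (Fp L) L))),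
      (S : Matrix (Fin n) (Fin n) L) ≠ 0 → (S : Matrix (Fin n) (Fin n) L).det = 0 → ∀ (s : ℂ) (h : HA L e dV hdV dW hdW), (n : ℝ) / 2 < s.re →
        Ec₁ S s h = (∏ p ∈ P, (s - p)) * fourierCoeffDelta L e dV hdV dW hdW νN β (S : Matrix (Fin n) (Fin n) L) (eisensteinFamilyDelta L e dV hdV dW hdW f s) h)
    (w₁ : skewMatrices ((IsCMField.complexConj L : L ≃ₐ[Fp L] L) : L →+* L) ((gramR L e dV hdV dW hdW).map (algebraMap (Fp L) L)) → ℝ) (hw₁ : ∀ S, 0 ≤ w₁ S) (hws₁ : Summable w₁)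
    (h1g : ∀ z : ℂ, 0 < z.re → ∃ C A r : ℝ, 0 ≤ C ∧ 0 ≤ A ∧ 0 < r ∧ ∀ S (s : ℂ), dist s z < r → ∀ h : HA L e dV hdV dW hdW,
      ‖Ec₁ S s h‖ ≤ C * w₁ S * adelicHeightGL (n + n) L (h : GL (Fin (n + n)) (AdeleRing (𝓞 L) L)) ^ A)
    -- KIND W: factor data + weighted growth + Euler identity∕continuity (rows G1–G4 + glue)
    (WT GW : skewMatrices ((IsCMField.complexConj L : L ≃ₐ[Fp L] L) : L →+* L) ((gramR L e dV hdV dW hdW).map (algebraMap (Fp L) L)) → ℂ → HA L e dV hdV dW hdW → ℂ)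
    (hWTd : ∀ S (h : HA L e dV hdV dW hdW), DifferentiableOn ℂ (fun s => WT S s h) {s : ℂ | 0 < s.re})
    (hGWd : ∀ S (h : HA L e dV hdV dW hdW), DifferentiableOn ℂ (fun s => GW S s h) {s : ℂ | 0 < s.re})
    (w : skewMatrices ((IsCMField.complexConj L : L ≃ₐ[Fp L] L) : L →+* L) ((gramR L e dV hdV dW hdW).map (algebraMap (Fp L) L)) → ℝ) (hw0 : ∀ S, 0 ≤ w S) (hws : Summable w)
    (hg : ∀ z : ℂ, 0 < z.re → ∃ C A r : ℝ, 0 ≤ C ∧ 0 ≤ A ∧ 0 < r ∧ ∀ S (s : ℂ), dist s z < r → ∀ h : HA L e dV hdV dW hdW,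
      ‖WT S s h * GW S s h‖ ≤ C * w S * adelicHeightGL (n + n) L (h : GL (Fin (n + n)) (AdeleRing (𝓞 L) L)) ^ A)
    (hRKc : ∀ S : skewMatrices ((IsCMField.complexConj L : L ≃ₐ[Fp L] L) : L →+* L) ((gramR L e dV hdV dW hdW).map (algebraMap (Fp L) L)),
      (S : Matrix (Fin n) (Fin n) L).det ≠ 0 → ∀ s : ℂ, (n : ℝ) / 2 < s.re →
        Continuous fun h : HA L e dV hdV dW hdW =>
          fourierCoeffDelta L e dV hdV dW hdW νN β (S : Matrix (Fin n) (Fin n) L) (eisensteinFamilyDelta L e dV hdV dW hdW f s) h)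
    (hRK : ∀ S : skewMatrices ((IsCMField.complexConj L : L ≃ₐ[Fp L] L) : L →+* L) ((gramR L e dV hdV dW hdW).map (algebraMap (Fp L) L)),
      (S : Matrix (Fin n) (Fin n) L).det ≠ 0 → ∀ (s : ℂ) (h : HA L e dV hdV dW hdW), (n : ℝ) / 2 < s.re →
        fourierCoeffDelta L e dV hdV dW hdW νN β (S : Matrix (Fin n) (Fin n) L) (eisensteinFamilyDelta L e dV hdV dW hdW f s) h = WT S s h * GW S s h) :
    ∃ (P : Finset ℂ) (Es : ℂ → HA L e dV hdV dW hdW → ℂ),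
      (∀ h : HA L e dV hdV dW hdW, DifferentiableOn ℂ (fun s => Es s h) {s : ℂ | 0 < s.re}) ∧
      (∀ s : ℂ, 0 < s.re → Continuous (Es s)) ∧
      (∀ s : ℂ, 0 < s.re → ∀ (γ : ratH L e dV hdV dW hdW) (h : HA L e dV hdV dW hdW),
        Es s ((γ : HA L e dV hdV dW hdW) * h) = Es s h) ∧
      (∀ (s : ℂ) (h : HA L e dV hdV dW hdW), (n : ℝ) / 2 < s.re →
        Es s h = (∏ p ∈ P, (s - p)) * eisensteinFamilyDelta L e dV hdV dW hdW f s h) ∧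
      (∀ z : ℂ, 0 < z.re → ∃ C A r : ℝ, 0 < r ∧ ∀ s : ℂ, dist s z < r → ∀ h : HA L e dV hdV dW hdW,
        ‖Es s h‖ ≤ C * adelicHeightGL (n + n) L (h : GL (Fin (n + n)) (AdeleRing (𝓞 L) L)) ^ A) := by
  have hn : 0 < n := by
    have h2 : Fintype.card (Fin 2 × Fin 1) = Fintype.card (Fin n) := Fintype.card_congr e
    simp only [Fintype.card_prod, Fintype.card_fin] at h2
    omega
  haveI : NeZero n := ⟨hn.ne'⟩
  have hχ : (toHeckeCharacter L lam⁻¹).IsUnitary := isUnitary_toHeckeCharacter L lam⁻¹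
  -- KIND W: packages (★ p861446) and lattice letters (★ p861512)
  obtain ⟨EcW, hWoff, hWd, hWc, hWcoef, hWg⟩ := exists_whittaker_packages_fourierCoeff_fixedCarrier L hn e dV hdV dW hdW νN β f WT GW hWTd hGWd w hw0 hg hRKc hRK P
  -- KIND 0: big cell (★ p861499 over ★ p861423), middle (rescaled), identity (★ `standardFamily_growth`), O41.4 finiteness (★ ed. 4a′), assembly (★ ed. 4a)
  obtain ⟨E₈, h8d, h8c, h8eq, h8g⟩ :=
    exists_E₈ L e dV hdV dW hdW hdV0 hdW0 𝒦 νN β (toHeckeCharacter L lam⁻¹) hχ f hstd hcont P r G hG hrG a hra E hEd hEeq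
  obtain ⟨h7d', h7c', h7eq', h7g'⟩ := smul_package (fun h : HA L e dV hdV dW hdW => adelicHeightGL (n + n) L (h : GL (Fin (n + n)) (AdeleRing (𝓞 L) L)))
    ((∫⁻ u, β u ∂νN).toReal⁻¹) P _ E₇ h7d h7c h7eq h7g
  obtain ⟨Ec₀, hd₀, hc₀, hcoef₀, hbd₀, hgr₀⟩ := exists_constantTerm_package L e dV hdV dW hdW hn νN hβ hβ0 hβtop wq hwq f hstd.1.1 hcont
    (fun h => (hstd.1.2 h).differentiableOn) (standardFamily_growth L e dV hdV dW hdW 𝒦 hχ f hstd hcont)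
    (fun s h hs => lintegral_tsum_enorm_mul_weight_ne_top L e dV hdV dW hdW hdV0 hdW0 hχ hs (hstd.1.1 s) (hcont s) νN hβtop hK hβK h)
    P E₈ h8d h8c h8eq h8g (fun s h => (∫⁻ u, β u ∂νN).toReal⁻¹ • E₇ s h) h7d' h7c' h7eq' h7g'
  -- ★ edition 3b
  exact siegelEisensteinContinuation_of_kinds_fixedCarrier L e dV hdV hdV0 dW hdW hdW0 lam hlam hw 𝒦 h𝒦 f hstd hcont νN β hβ hβ0 hβtop P
    Ec₀ hd₀ hc₀ hcoef₀ hbd₀ hgr₀ Ec₁ h1off hd₁ hc₁ hcoef₁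
    (whittaker_majorant_of_weightedGrowth L hn e dV hdV dW hdW Ec₁ w₁ hw₁ hws₁ h1g) (whittaker_summedGrowth_of_weightedGrowth L e dV hdV dW hdW Ec₁ w₁ hws₁ h1g)
    EcW hWoff hWd hWc hWcoef
    (whittaker_majorant_of_weightedGrowth L hn e dV hdV dW hdW EcW w hw0 hws hWg) (whittaker_summedGrowth_of_weightedGrowth L e dV hdV dW hdW EcW w hws hWg)

end Summit.HodgeConjecture.HodgeConjecture.Cruxes.HLiu418.K2LiuSiegelEisensteinContinuationTopAssembled

end
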